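import Literature.NumberTheory.Transcendental.KZLogCalculusProofs
import Summits.KontsevichZagierPeriods.KontsevichZagierPeriods.Theorems.ValuedFieldSpecialisationParametricLiftingFrullaniDilation

/-!
# Route ValuedFieldSpecialisation — crux `ParametricLifting`: the big Frullani band

Helper toward crux stmt-KontsevichZagierPeriods-3498 (`ParametricLifting`), line `registered`,
stub `frullani_exists_bigRep` of the lead's Frullani calibration (c6). In coordinates `z 0 = s`
(the parameter) and `z 1 = t` (the fibre variable) over the base
`G = {y : Fin 1 → ℝ | 0 < y 0 ∧ 2 * y 0 < 1}`, we CONSTRUCT the integral representation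
`A₂ = ({(s, t) | s ∈ G, s ≤ t ≤ 2}, 1 / (t (1 + t)))`, the one family (divergent as `s → 0⁺`, its
slice values grow like `log (1/s)`) of which all the other Frullani families are restrictions. Its
domain is the band `KZlog.band G (fun y => y 0) (fun _ => 2)` (semialgebraic by
`KZlog.isSemialgebraic_band`), its integrand is a rational function with non-vanishing denominator
on the band, and it is absolutely integrable because the fibre integrals satisfy
`∫_s^2 dt/(t(1+t)) ≤ ∫_s^2 dt/t = log (2/s)`, an integrable function of `s` on `(0, 1/2]`
(`KZlog.integrableOn_band_of_lintegral_fibre_le`, Tonelli along the fibre; the integrability of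
`log` near `0` is `intervalIntegral.intervalIntegrable_log'`, transported to `ℝ¹` by
`MeasureTheory.volume_preserving_funUnique`).

Sources: M. Kontsevich, D. Zagier, *Periods* (2001), §1.1–1.2; G. Boros, V. Moll,
*Irresistible Integrals* (2004), §5.6 (Frullani). No new definitions.
-/

noncomputable section

namespace Summit.KontsevichZagierPeriods.ValuedFieldSpecialisation

open MeasureTheory Set Filter MvPolynomial
open scoped Topology
open Literature.NumberTheory.Transcendental Literature.NumberTheory.Transcendental.KZ
open Literature.ModelTheory.ExponentialFields (IsSemialgebraic isSemialgebraic_setOf_eval_pos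
  isSemialgebraic_setOf_eval_lt isSemialgebraic_setOf_eval_le)

/-- The big Frullani band `{(s, t) | 0 < s, 2 s < 1, s ≤ t ≤ 2} ⊆ ℝ²` is `ℚ`-semialgebraic
(`KZlog.isSemialgebraic_band`: polynomial edges over the semialgebraic base,
`frullani_dilation_isSemialgebraic_base`). [folklore] -/
theorem frullani_isSemialgebraic_bigBand :
    IsSemialgebraic ℚ (KZlog.band {y : Fin 1 → ℝ | 0 < y 0 ∧ 2 * y 0 < 1} (fun y => y 0)
      (fun _ => 2)) := by
  have hG := frullani_dilation_isSemialgebraic_base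
  refine KZlog.isSemialgebraic_band ?_ ?_
  · exact (isSemialgebraicFunOn_aeval hG (X 0)).congr fun y _ => by simp
  · exact (isSemialgebraicFunOn_aeval hG (C 2)).congr fun y _ => by simp

/-- On the big band the fibre variable is positive: `0 < s ≤ t`. [folklore] -/
theorem frullani_bigBand_pos {z : Fin (1 + 1) → ℝ}
    (hz : z ∈ KZlog.band {y : Fin 1 → ℝ | 0 < y 0 ∧ 2 * y 0 < 1} (fun y => y 0) (fun _ => 2)) :
    0 < z 1 :=
  lt_of_lt_of_le hz.1.1 hz.2.1

/-- The integrand `1/(t(1+t))` is a `ℚ`-semialgebraic function on the big band (a rational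
function whose denominator does not vanish there). [folklore] -/
theorem frullani_isSemialgebraicFunOn_bigBand :
    IsSemialgebraicFunOn ℚ (KZlog.band {y : Fin 1 → ℝ | 0 < y 0 ∧ 2 * y 0 < 1} (fun y => y 0)
      (fun _ => 2)) (fun z : Fin (1 + 1) → ℝ => (z 1 * (1 + z 1))⁻¹) :=
  (isSemialgebraicFunOn_aeval_div_aeval frullani_isSemialgebraic_bigBand 1 (X 1 * (1 + X 1))
    fun z hz => by
      have h := frullani_bigBand_pos hz
      simpa using (mul_pos h (by linarith)).ne').congr fun z _ => by simp

/-- The fibre integrals of `1/(t(1+t))` over `[s, 2]`, `0 < s ≤ 2`, are at most `log (2/s)`: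
`1/(t(1+t)) ≤ 1/t` there and `∫_s^2 dt/t = log (2/s)` (`integral_inv_of_pos`).
[Kontsevich–Zagier 2001, §1.1] [folklore] -/
theorem frullani_lintegral_fibre_le {s : ℝ} (hs : 0 < s) (hs2 : s ≤ 2) :
    ∫⁻ t in Icc s 2, ‖(t * (1 + t))⁻¹‖ₑ ≤ ‖Real.log (2 / s)‖ₑ := by
  have hpos : ∀ t ∈ Icc s 2, 0 < t := fun t ht => hs.trans_le ht.1
  have hint : IntegrableOn (fun t : ℝ => t⁻¹) (Icc s 2) :=
    ContinuousOn.integrableOn_Icc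
      (continuousOn_inv₀.mono fun t ht => Set.mem_compl_singleton_iff.2 (hpos t ht).ne')
  calc ∫⁻ t in Icc s 2, ‖(t * (1 + t))⁻¹‖ₑ
      ≤ ∫⁻ t in Icc s 2, ENNReal.ofReal t⁻¹ := by
        refine setLIntegral_mono' measurableSet_Icc fun t ht => ?_
        have ht0 := hpos t ht
        rw [Real.enorm_eq_ofReal (inv_nonneg.2 (mul_pos ht0 (by linarith)).le)]
        refine ENNReal.ofReal_le_ofReal ?_
        rw [mul_inv]
        exact mul_le_of_le_one_right (inv_nonneg.2 ht0.le)
          (inv_le_one_of_one_le₀ (by linarith))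
    _ = ENNReal.ofReal (∫ t in Icc s 2, t⁻¹) :=
        (ofReal_integral_eq_lintegral_ofReal hint
          ((ae_restrict_mem measurableSet_Icc).mono fun t ht => inv_nonneg.2 (hpos t ht).le)).symm
    _ = ‖Real.log (2 / s)‖ₑ := by
        rw [integral_Icc_eq_integral_Ioc, ← intervalIntegral.integral_of_le hs2,
          integral_inv_of_pos hs two_pos,
          Real.enorm_eq_ofReal (Real.log_nonneg ((one_le_div hs).2 hs2))]

/-- `s ↦ log (2/s)` is integrable on `{0 < s, 2 s < 1} ⊆ ℝ¹` (`log` is integrable at `0⁺`,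
`intervalIntegral.intervalIntegrable_log'`, transported along `ℝ¹ ≃ ℝ`). [folklore] -/
theorem frullani_integrableOn_log_base :
    IntegrableOn (fun x : Fin 1 → ℝ => Real.log (2 / x 0))
      {y : Fin 1 → ℝ | 0 < y 0 ∧ 2 * y 0 < 1} := by
  have hlog : IntegrableOn (fun s : ℝ => Real.log (2 / s)) (Ioc 0 (1 / 2)) := by
    have h1 : IntegrableOn Real.log (Ioc 0 (1 / 2)) :=
      (intervalIntegral.intervalIntegrable_log' (a := 0) (b := 1 / 2)).1
    have h2 : IntegrableOn (fun _ : ℝ => Real.log 2) (Ioc 0 (1 / 2)) :=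
      integrableOn_const (hs := measure_Ioc_lt_top.ne)
    refine (h2.sub h1).congr_fun (fun s hs => ?_) measurableSet_Ioc
    simp only [Pi.sub_apply]
    rw [Real.log_div two_ne_zero hs.1.ne']
  have h' : IntegrableOn (fun x : Fin 1 → ℝ => Real.log (2 / x 0))
      {x : Fin 1 → ℝ | x 0 ∈ Ioc (0 : ℝ) (1 / 2)} :=
    ((volume_preserving_funUnique (Fin 1) ℝ).integrableOn_comp_preimage
      (MeasurableEquiv.funUnique (Fin 1) ℝ).measurableEmbedding).2 hlog
  exact h'.mono_set fun x hx => ⟨hx.1, by linarith [hx.2]⟩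

/-- **Integrability on the big band.** `1/(t(1+t))` is absolutely integrable on
`{0 < s, 2 s < 1, s ≤ t ≤ 2}`: by Tonelli along the fibre its absolute integral is at most
`∫_0^{1/2} log (2/s) ds < ∞` (`KZlog.integrableOn_band_of_lintegral_fibre_le`).
[Kontsevich–Zagier 2001, §1.1] [folklore] -/
theorem frullani_integrableOn_bigBand :
    IntegrableOn (fun z : Fin (1 + 1) → ℝ => (z 1 * (1 + z 1))⁻¹)
      (KZlog.band {y : Fin 1 → ℝ | 0 < y 0 ∧ 2 * y 0 < 1} (fun y => y 0) (fun _ => 2)) := by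
  have hGm : MeasurableSet {y : Fin 1 → ℝ | 0 < y 0 ∧ 2 * y 0 < 1} :=
    Literature.ModelTheory.ExponentialFields.IsSemialgebraic.measurableSet_holds
      frullani_dilation_isSemialgebraic_base
  have hBm : MeasurableSet (KZlog.band {y : Fin 1 → ℝ | 0 < y 0 ∧ 2 * y 0 < 1} (fun y => y 0)
      (fun _ => (2 : ℝ))) :=
    Literature.ModelTheory.ExponentialFields.IsSemialgebraic.measurableSet_holds
      frullani_isSemialgebraic_bigBand
  have hWm : Measurable (fun z : Fin (1 + 1) → ℝ => (z 1 * (1 + z 1))⁻¹) := by fun_prop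
  refine KZlog.integrableOn_band_of_lintegral_fibre_le hGm hBm (fun x t => KZlog.snoc_mem_band)
    hWm.aestronglyMeasurable (K := fun x => Real.log (2 / x 0)) (fun x hx => ?_)
    frullani_integrableOn_log_base
  have h1 : ∀ t : ℝ, (Fin.snoc x t : Fin (1 + 1) → ℝ) 1 = t := fun t => rfl
  simp only [h1]
  exact frullani_lintegral_fibre_le hx.1 (by linarith [hx.2])

/-- **Stub A (the big band).** The family `A₂ = ({0 < s, 2s < 1, s ≤ t ≤ 2}, 1/(t(1+t)))` is an
integral representation (integrable: fibre integrals `≤ log 2 − log s`, integrable in `s`).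
[Kontsevich–Zagier 2001, §1.1] [folklore] -/
theorem frullani_exists_bigRep :
    ∃ A₂ : KZ.IntegralRep (1 + 1), A₂.domain = KZlog.band {y : Fin 1 → ℝ | 0 < y 0 ∧ 2 * y 0 < 1} (fun y => y 0) (fun _ => 2) ∧ A₂.integrand = fun z => (z 1 * (1 + z 1))⁻¹ := by
  exact ⟨⟨_, _, frullani_isSemialgebraic_bigBand, frullani_isSemialgebraicFunOn_bigBand,
    frullani_integrableOn_bigBand⟩, rfl, rfl⟩

end Summit.KontsevichZagierPeriods.ValuedFieldSpecialisation
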